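import Summits.PneNP.PneNP.Theorems.PhaseTwinsConstantFactorTwinsEverywhereDefs
import Mathlib.Data.Set.Card
import Literature.ModelTheory.FiniteModelTheory.CountingWidthParameter

/-!
# Route PhaseTwins, support `ConstantFactorTwinsEverywhere` (stmt-PneNP-2726): the split grids

The base graphs of the CFI construction (`splitGrid m`, `splitGridFin m` of the definitions file):
* maximum degree `≤ 3` (`degree_splitGrid_le`, `degree_splitGridFin_le`);
* connected for `m ≥ 1` (`connected_splitGridFin`);
* NO SMALL SEPARATORS (`not_isCFISeparator_splitGridFin`): if `2k < m`, no set of at most `k`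
  vertices is a separator in the sense of Cai–Fürer–Immerman (`IsCFISeparator`: every component of
  the rest has at most half of the vertices) — the layer-`0` halves of the `≥ m - k` rows and the
  layer-`1` halves of the `≥ m - k` columns containing no removed vertex form a connected set of
  `≥ 2m(m-k) > m² = v/2` vertices. This is the hypothesis of the tree's Cai–Fürer–Immerman theorem
  `ckEquiv_cfiEven_cfiGraph_of_separator` (CFI 1992, Thm 6.4).
-/

namespace Summit.PneNP.PneNP.PhaseTwins.ConstantFactorTwins

-- `Summit.PneNP.PneNP.…` (summit = sub-problem name) trips the duplicate-namespace linter on every declaration.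
set_option linter.dupNamespace false

open Finset
open Literature.ModelTheory.FiniteModelTheory
open Literature.ModelTheory.FiniteModelTheory (IsCFISeparator)

variable {m : ℕ}

/-! ### Degrees -/

/-- A vertex has at most one neighbour in each direction. -/
theorem dirCode_injOn (a : SGVert m) {b b' : SGVert m} (hb : (splitGrid m).Adj a b)
    (hb' : (splitGrid m).Adj a b') (h : dirCode a b = dirCode a b') : b = b' := by
  obtain ⟨i, j, l⟩ := a
  obtain ⟨i₁, j₁, l₁⟩ := b
  obtain ⟨i₂, j₂, l₂⟩ := b'
  rw [splitGrid_adj] at hb hb'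
  simp only [dirCode, ne_eq, Prod.mk.injEq, Fin.ext_iff, Fin.val_zero, Fin.val_one]
    at hb hb' h ⊢
  have hl := l.isLt; have hl₁ := l₁.isLt; have hl₂ := l₂.isLt
  split_ifs at h <;> simp_all <;> omega

/-- **The split grid has maximum degree `≤ 3`.** -/
theorem degree_splitGrid_le (a : SGVert m) : (splitGrid m).degree a ≤ 3 := by
  rw [← SimpleGraph.card_neighborFinset_eq_degree]
  calc ((splitGrid m).neighborFinset a).card ≤ (univ : Finset (Fin 3)).card :=
        Finset.card_le_card_of_injOn (dirCode a) (fun _ _ => mem_coe.2 (mem_univ _))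
          fun b hb b' hb' h => dirCode_injOn a
            ((SimpleGraph.mem_neighborFinset _ _ _).1 (mem_coe.1 hb))
            ((SimpleGraph.mem_neighborFinset _ _ _).1 (mem_coe.1 hb')) h
    _ = 3 := by simp

/-- The numbered split grid has maximum degree `≤ 3`. -/
theorem degree_splitGridFin_le (a : Fin (m * (m * 2))) : (splitGridFin m).degree a ≤ 3 := by
  have h := (splitGridFinIso m).degree_eq a
  rw [← h]
  convert degree_splitGrid_le ((splitGridFinIso m) a)

/-! ### Walks inside a vertex set -/

/-- Consecutive vertices of a row (layer `0`) are adjacent. -/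
theorem adj_row_succ (i : Fin m) {n : ℕ} (h : n + 1 < m) :
    (splitGrid m).Adj (i, ⟨n, Nat.lt_of_succ_lt h⟩, 0) (i, ⟨n + 1, h⟩, 0) := by
  rw [splitGrid_adj]
  refine ⟨?_, Or.inl (Or.inl ⟨rfl, rfl, rfl, rfl⟩)⟩
  simp [Prod.ext_iff, Fin.ext_iff]

/-- Consecutive vertices of a column (layer `1`) are adjacent. -/
theorem adj_col_succ (j : Fin m) {n : ℕ} (h : n + 1 < m) :
    (splitGrid m).Adj (⟨n, Nat.lt_of_succ_lt h⟩, j, 1) (⟨n + 1, h⟩, j, 1) := by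
  rw [splitGrid_adj]
  refine ⟨?_, Or.inl (Or.inr (Or.inl ⟨rfl, rfl, rfl, rfl⟩))⟩
  simp [Prod.ext_iff, Fin.ext_iff]

/-- The two halves of a grid point are adjacent. -/
theorem adj_rung (i j : Fin m) : (splitGrid m).Adj (i, j, 0) (i, j, 1) := by
  rw [splitGrid_adj]
  refine ⟨?_, Or.inl (Or.inr (Or.inr ⟨rfl, rfl, rfl, rfl⟩))⟩
  simp [Prod.ext_iff]

/-- Along a row lying inside `X` (layer `0`). -/
theorem reachable_row {X : Set (SGVert m)} {i : Fin m} (hrow : ∀ j, (i, j, (0 : Fin 2)) ∈ X)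
    (j j' : Fin m) :
    ((splitGrid m).induce X).Reachable ⟨(i, j, 0), hrow j⟩ ⟨(i, j', 0), hrow j'⟩ := by
  have h0 : 0 < m := j.pos
  have key : ∀ n (hn : n < m),
      ((splitGrid m).induce X).Reachable ⟨(i, ⟨0, h0⟩, 0), hrow _⟩ ⟨(i, ⟨n, hn⟩, 0), hrow _⟩ := by
    intro n
    induction n with
    | zero => intro hn; exact SimpleGraph.Reachable.refl _
    | succ n ih =>
      intro hn
      refine (ih (Nat.lt_of_succ_lt hn)).trans (SimpleGraph.Adj.reachable ?_)
      simp only [SimpleGraph.comap_adj, Function.Embedding.coe_subtype]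
      exact adj_row_succ i hn
  exact (key j j.isLt).symm.trans (key j' j'.isLt)

/-- Along a column lying inside `X` (layer `1`). -/
theorem reachable_col {X : Set (SGVert m)} {j : Fin m} (hcol : ∀ i, (i, j, (1 : Fin 2)) ∈ X)
    (i i' : Fin m) :
    ((splitGrid m).induce X).Reachable ⟨(i, j, 1), hcol i⟩ ⟨(i', j, 1), hcol i'⟩ := by
  have h0 : 0 < m := i.pos
  have key : ∀ n (hn : n < m),
      ((splitGrid m).induce X).Reachable ⟨(⟨0, h0⟩, j, 1), hcol _⟩ ⟨(⟨n, hn⟩, j, 1), hcol _⟩ := by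
    intro n
    induction n with
    | zero => intro hn; exact SimpleGraph.Reachable.refl _
    | succ n ih =>
      intro hn
      refine (ih (Nat.lt_of_succ_lt hn)).trans (SimpleGraph.Adj.reachable ?_)
      simp only [SimpleGraph.comap_adj, Function.Embedding.coe_subtype]
      exact adj_col_succ j hn
  exact (key i i.isLt).symm.trans (key i' i'.isLt)

/-- Across a rung inside `X`. -/
theorem reachable_rung {X : Set (SGVert m)} {i j : Fin m} (h0 : (i, j, (0 : Fin 2)) ∈ X)
    (h1 : (i, j, (1 : Fin 2)) ∈ X) :
    ((splitGrid m).induce X).Reachable ⟨(i, j, 0), h0⟩ ⟨(i, j, 1), h1⟩ := by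
  refine SimpleGraph.Adj.reachable ?_
  simp only [SimpleGraph.comap_adj, Function.Embedding.coe_subtype]
  exact adj_rung i j

/-- Reaching a vertex of `X` from the crossing of a clean row `i₀` and a clean column `j₀`, inside `X`,
when the vertex lies on a clean row (layer `0`) or a clean column (layer `1`). -/
theorem reachable_of_clean {X : Set (SGVert m)} {i₀ j₀ : Fin m} (hrow₀ : ∀ j, (i₀, j, (0 : Fin 2)) ∈ X)
    (hcol₀ : ∀ i, (i, j₀, (1 : Fin 2)) ∈ X) {i j : Fin m} {l : Fin 2}
    (hy : (l = 0 ∧ ∀ j', (i, j', (0 : Fin 2)) ∈ X) ∨ (l = 1 ∧ ∀ i', (i', j, (1 : Fin 2)) ∈ X))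
    (hyX : (i, j, l) ∈ X) :
    ((splitGrid m).induce X).Reachable ⟨(i₀, j₀, 0), hrow₀ j₀⟩ ⟨(i, j, l), hyX⟩ := by
  rcases hy with ⟨hl, hi⟩ | ⟨hl, hj⟩
  · subst hl
    -- x₀ → (i₀,j₀,1) → (i,j₀,1) → (i,j₀,0) → (i,j,0)
    exact (((reachable_rung (hrow₀ j₀) (hcol₀ i₀)).trans (reachable_col hcol₀ i₀ i)).trans
      (reachable_rung (hi j₀) (hcol₀ i)).symm).trans (reachable_row hi j₀ j)
  · subst hl
    -- x₀ → (i₀,j,0) → (i₀,j,1) → (i,j,1)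
    exact ((reachable_row hrow₀ j₀ j).trans (reachable_rung (hrow₀ j) (hj i₀))).trans
      (reachable_col hj i₀ i)

/-- The split grid is connected (`m ≥ 1`). -/
theorem connected_splitGrid (hm : 0 < m) : (splitGrid m).Connected := by
  haveI : Nonempty (SGVert m) := ⟨(⟨0, hm⟩, ⟨0, hm⟩, 0)⟩
  refine SimpleGraph.Connected.mk fun a b => ?_
  have key : ∀ y : SGVert m, (splitGrid m).Reachable (⟨0, hm⟩, ⟨0, hm⟩, 0) y := by
    rintro ⟨i, j, l⟩
    have hl : (l = 0 ∧ ∀ j', (i, j', (0 : Fin 2)) ∈ (Set.univ : Set (SGVert m))) ∨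
        (l = 1 ∧ ∀ i', (i', j, (1 : Fin 2)) ∈ (Set.univ : Set (SGVert m))) := by
      rcases Fin.exists_fin_two.1 ⟨l, rfl⟩ with h | h
      · exact Or.inl ⟨h, fun _ => Set.mem_univ _⟩
      · exact Or.inr ⟨h, fun _ => Set.mem_univ _⟩
    have h := reachable_of_clean (X := Set.univ) (i₀ := ⟨0, hm⟩) (j₀ := ⟨0, hm⟩)
      (fun _ => Set.mem_univ _) (fun _ => Set.mem_univ _) hl (Set.mem_univ _)
    exact h.map (SimpleGraph.Embedding.induce (Set.univ : Set (SGVert m))).toHom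
  exact (key a).symm.trans (key b)

/-- The split grid on `Fin (2m²)` is connected (`m ≥ 1`). -/
theorem connected_splitGridFin (hm : 0 < m) : (splitGridFin m).Connected :=
  (splitGridFinIso m).connected_iff.2 (connected_splitGrid hm)

/-! ### A big connected set certifies that a small set is not a separator -/

/-- If more than half of the vertices are reachable from one vertex inside the complement of `S`,
then `S` is not a separator in the sense of Cai–Fürer–Immerman. -/
theorem not_isCFISeparator_of_reachable {v : ℕ} (T : SimpleGraph (Fin v)) (S : Set (Fin v))
    (X : Set (Fin v)) (hXS : X ⊆ Sᶜ) {x₀ : Fin v} (hx₀ : x₀ ∈ X)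
    (hreach : ∀ y (hy : y ∈ X), (T.induce Sᶜ).Reachable ⟨x₀, hXS hx₀⟩ ⟨y, hXS hy⟩)
    (hbig : v < 2 * X.ncard) : ¬ IsCFISeparator T S := by
  classical
  intro hsep
  have h := hsep ((T.induce Sᶜ).connectedComponentMk ⟨x₀, hXS hx₀⟩)
  have hle : X.ncard ≤ ((T.induce Sᶜ).connectedComponentMk ⟨x₀, hXS hx₀⟩).supp.ncard := by
    refine Set.ncard_le_ncard_of_injOn (fun y => if hy : y ∈ X then ⟨y, hXS hy⟩ else ⟨x₀, hXS hx₀⟩)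
      ?_ ?_ (Set.toFinite _)
    · intro y hy
      simp only [dif_pos hy, SimpleGraph.ConnectedComponent.mem_supp_iff,
        SimpleGraph.ConnectedComponent.eq]
      exact (hreach y hy).symm
    · intro y hy y' hy' hyy'
      simp only [dif_pos hy, dif_pos hy'] at hyy'
      exact congrArg Subtype.val hyy'
  omega

/-! ### The split grid has no small separators -/

/-- **No small separators.** If `2 k < m`, every set of at most `k` vertices of the split grid
leaves a connected part with more than half of the vertices: the layer-`0` halves of the rows
and the layer-`1` halves of the columns that contain no removed vertex. -/
theorem not_isCFISeparator_splitGridFin {k : ℕ} (hkm : 2 * k < m) (S : Set (Fin (m * (m * 2))))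
    (hS : S.ncard ≤ k) : ¬ IsCFISeparator (splitGridFin m) S := by
  classical
  set e := sgEquiv m with he
  -- the removed vertices, read in grid coordinates, and the rows/columns they spoil
  set S' : Finset (SGVert m) := univ.filter fun x => e x ∈ S with hS'
  have hmemS' : ∀ x, x ∈ S' ↔ e x ∈ S := fun x => by simp [hS']
  have hcardS' : S'.card ≤ k := by
    have h1 : S'.card ≤ S.toFinset.card :=
      Finset.card_le_card_of_injOn e (fun x hx => by
        simpa [Set.mem_toFinset] using (hmemS' x).1 (mem_coe.1 hx))
        fun x _ y _ hxy => e.injective hxy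
    rw [← Set.ncard_eq_toFinset_card'] at h1
    exact h1.trans hS
  set DR : Finset (Fin m) := S'.image fun x => x.1 with hDR
  set DC : Finset (Fin m) := S'.image fun x => x.2.1 with hDC
  have hDRk : DR.card ≤ k := Finset.card_image_le.trans hcardS'
  have hDCk : DC.card ≤ k := Finset.card_image_le.trans hcardS'
  have hkm' : k < m := by omega
  obtain ⟨i₀, hi₀⟩ : ∃ i₀ : Fin m, i₀ ∉ DR := by
    by_contra h
    push Not at h
    have : (univ : Finset (Fin m)).card ≤ DR.card := Finset.card_le_card fun i _ => h i
    rw [card_univ, Fintype.card_fin] at this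
    omega
  obtain ⟨j₀, hj₀⟩ : ∃ j₀ : Fin m, j₀ ∉ DC := by
    by_contra h
    push Not at h
    have : (univ : Finset (Fin m)).card ≤ DC.card := Finset.card_le_card fun i _ => h i
    rw [card_univ, Fintype.card_fin] at this
    omega
  -- the big connected set
  set X : Set (SGVert m) := {x | (x.2.2 = 0 ∧ x.1 ∉ DR) ∨ (x.2.2 = 1 ∧ x.2.1 ∉ DC)} with hX
  have hXS' : ∀ x ∈ X, e x ∉ S := by
    rintro ⟨i, j, l⟩ hx hxS
    have hx' : (i, j, l) ∈ S' := (hmemS' _).2 hxS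
    rcases hx with ⟨-, hi⟩ | ⟨-, hj⟩
    · exact hi (mem_image_of_mem (fun x : SGVert m => x.1) hx')
    · exact hj (mem_image_of_mem (fun x : SGVert m => x.2.1) hx')
  have hrow : ∀ {i : Fin m}, i ∉ DR → ∀ j, (i, j, (0 : Fin 2)) ∈ X := fun hi j => Or.inl ⟨rfl, hi⟩
  have hcol : ∀ {j : Fin m}, j ∉ DC → ∀ i, (i, j, (1 : Fin 2)) ∈ X := fun hj i => Or.inr ⟨rfl, hj⟩
  have hx₀ : (i₀, j₀, (0 : Fin 2)) ∈ X := hrow hi₀ j₀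
  have hreach : ∀ y (hy : y ∈ X), ((splitGrid m).induce X).Reachable ⟨(i₀, j₀, 0), hx₀⟩ ⟨y, hy⟩ := by
    rintro ⟨i, j, l⟩ hy
    refine reachable_of_clean (hrow hi₀) (hcol hj₀) ?_ hy
    rcases id hy with ⟨hl, hi⟩ | ⟨hl, hj⟩
    · exact Or.inl ⟨hl, hrow hi⟩
    · exact Or.inr ⟨hl, hcol hj⟩
  -- transport to `Fin v`
  let φ : splitGrid m →g splitGridFin m := (splitGridFinIso m).symm.toHom
  have hφ : ∀ x, φ x = e x := fun x => rfl
  have hmaps : Set.MapsTo φ X Sᶜ := fun x hx => by rw [hφ]; exact hXS' x hx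
  let ψ := SimpleGraph.induceHom φ hmaps
  have hXS : e '' X ⊆ Sᶜ := by
    rintro _ ⟨x, hx, rfl⟩; exact hXS' x hx
  refine not_isCFISeparator_of_reachable (splitGridFin m) S (e '' X) hXS
    (Set.mem_image_of_mem e hx₀) ?_ ?_
  · rintro _ ⟨y, hy, rfl⟩
    have h := (hreach y hy).map ψ
    exact h
  · -- counting: |X| = m (m - |DR|) + m (m - |DC|) ≥ 2 m (m - k) > m²·...
    rw [Set.ncard_image_of_injective _ e.injective]
    set A : Finset (SGVert m) := (univ \ DR) ×ˢ ((univ : Finset (Fin m)) ×ˢ ({0} : Finset (Fin 2)))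
      with hA
    set B : Finset (SGVert m) := (univ : Finset (Fin m)) ×ˢ ((univ \ DC) ×ˢ ({1} : Finset (Fin 2)))
      with hB
    have hXAB : X = ↑(A ∪ B) := by
      ext ⟨i, j, l⟩
      simp only [hX, hA, hB, Set.mem_setOf_eq, coe_union, coe_product, coe_sdiff, coe_univ,
        coe_singleton, Set.mem_union, Set.mem_prod, Set.mem_sdiff, Set.mem_univ, true_and,
        Set.mem_singleton_iff]
      tauto
    have hdisj : Disjoint A B := by
      rw [Finset.disjoint_left]
      rintro ⟨i, j, l⟩ hA' hB'
      simp only [hA, hB, mem_product, mem_sdiff, mem_univ, true_and, mem_singleton] at hA' hB'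
      have h0 : l = 0 := hA'.2
      have h1 : l = 1 := hB'.2
      rw [h0] at h1
      exact absurd h1 (by decide)
    have hcardA : A.card = (m - DR.card) * m := by
      simp [hA, card_product, card_sdiff, card_univ, Fintype.card_fin]
    have hcardB : B.card = m * (m - DC.card) := by
      simp [hB, card_product, card_sdiff, card_univ, Fintype.card_fin]
    rw [hXAB, Set.ncard_coe_finset, card_union_of_disjoint hdisj, hcardA, hcardB]
    have h1 : m - k ≤ m - DR.card := Nat.sub_le_sub_left hDRk m
    have h2 : m - k ≤ m - DC.card := Nat.sub_le_sub_left hDCk m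
    have h3 : m * 2 < 4 * (m - k) := by omega
    generalize m - k = c at h1 h2 h3
    generalize m - DR.card = a at h1
    generalize m - DC.card = b at h2
    have h4 : m * (m * 2) < m * (4 * c) := Nat.mul_lt_mul_of_pos_left h3 (by omega)
    have h5 : m * c ≤ m * a := Nat.mul_le_mul_left m h1
    have h6 : m * c ≤ m * b := Nat.mul_le_mul_left m h2
    linarith


end Summit.PneNP.PneNP.PhaseTwins.ConstantFactorTwins
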